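import Summits.Ventures.LatticeQCDFlow.Exactness.Phi4HMCFluctuationRelation
import HarnessLib

/-!
# Polynomial growth of the qpq leapfrog trajectory and of the HMC energy violation on lattice φ⁴

HONEST FRAMING: exact (Metropolis-corrected) sampling algorithms for lattice gauge theory;
figures of merit are autocorrelation/cost numbers at stated couplings and volumes; no
continuum-physics claim.  (SCALAR calibration rung S0-A: not a gauge result.)

Venture `LatticeQCDFlow` (cell pub-lqcd), topic `Exactness`; FANOUT row 2 (`s0-phi4`, HMC arm).
NEW WORK of the cell over Mathlib and row 2's files (`Scoring/FreeFieldLeapfrog.lean`: the qpq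
step `leapfrogQPQ`; `Exactness/Phi4LeapfrogPerm.lean`: `hmcProposal`; `Exactness/Phi4HMCExact.lean`:
`phi4HmcEnergy`; `Exactness/Phi4HMCFluctuationRelation.lean`: `hmcDeltaH`); nothing is cited as a
fact.  Toolbox for `Exactness/Phi4HMCEnergyViolationIntegrable.lean` (the first moment of `ΔH`
exists, making the model-free acceptance bound of `AcceptanceFromMeanEnergyViolation.lean`
unconditional for row 2's HMC).

## What is proved (phase space `(Fin (n+1) → ℝ) × (Fin (n+1) → ℝ)`, size `s(z) = 1 + Σφ² + Σp²`)

* `phaseSize` and its elementary bounds (`one_le_phaseSize`, `sq_fst_le_phaseSize`,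
  `abs_fst_le_phaseSize`, …); `abs_latticePhi4Force_le` — `|F_x(φ)| ≤ (A + 4|λ|) s²`,
  `A = Σ_{x,y}|J_{xy} + J_{yx}|`; `phaseSize_lfDrift_le` (`≤ (2 + 2τ²) s`), `phaseSize_lfKick_le`
  (`≤ (2 + 2δ²(n+1)(A+4|λ|)²) s⁴`), **`phaseSize_leapfrogQPQ_le`** — one qpq step maps size `s`
  to size `≤ C₁ s⁴`; **`phaseSize_iterate_le`** — `N` steps: `≤ C_N s^{4^N}`; `phaseSize_momFlip`.
* `abs_phi4HmcEnergy_le` — `|H(z)| ≤ (Σ|J| + |λ| + 1) s(z)²`; **`abs_hmcDeltaH_le`** —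
  `|ΔH(z)| ≤ C s(z)^{2·4^N}` with an explicit (crude) constant, every `J`, `λ`, `δ`, `N`.
-/

namespace Summit.Ventures.LatticeQCDFlow.Exactness

open Real MeasureTheory Filter Finset
open Summit.Ventures.LatticeQCDFlow.Scoring

variable {n : ℕ}

/-! ## The size function and one-step growth -/

/-- The size of a phase-space point: `s(φ, p) = 1 + Σ_x φ_x² + Σ_x p_x²` (`≥ 1`). -/
noncomputable def phaseSize (z : (Fin (n + 1) → ℝ) × (Fin (n + 1) → ℝ)) : ℝ :=
  1 + ∑ x, z.1 x ^ 2 + ∑ x, z.2 x ^ 2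

/-- `1 ≤ s(z)`. -/
theorem one_le_phaseSize (z : (Fin (n + 1) → ℝ) × (Fin (n + 1) → ℝ)) : 1 ≤ phaseSize z := by
  unfold phaseSize
  have h1 : 0 ≤ ∑ x, z.1 x ^ 2 := sum_nonneg fun _ _ => sq_nonneg _
  have h2 : 0 ≤ ∑ x, z.2 x ^ 2 := sum_nonneg fun _ _ => sq_nonneg _
  linarith

/-- `0 < s(z)`. -/
theorem phaseSize_pos (z : (Fin (n + 1) → ℝ) × (Fin (n + 1) → ℝ)) : 0 < phaseSize z :=
  zero_lt_one.trans_le (one_le_phaseSize z)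

/-- `Σ φ² ≤ s`. -/
theorem sum_sq_fst_le_phaseSize (z : (Fin (n + 1) → ℝ) × (Fin (n + 1) → ℝ)) :
    ∑ x, z.1 x ^ 2 ≤ phaseSize z := by
  unfold phaseSize
  have h2 : 0 ≤ ∑ x, z.2 x ^ 2 := sum_nonneg fun _ _ => sq_nonneg _
  linarith

/-- `Σ p² ≤ s`. -/
theorem sum_sq_snd_le_phaseSize (z : (Fin (n + 1) → ℝ) × (Fin (n + 1) → ℝ)) :
    ∑ x, z.2 x ^ 2 ≤ phaseSize z := by
  unfold phaseSize
  have h1 : 0 ≤ ∑ x, z.1 x ^ 2 := sum_nonneg fun _ _ => sq_nonneg _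
  linarith

/-- `φ_x² ≤ s`. -/
theorem sq_fst_le_phaseSize (z : (Fin (n + 1) → ℝ) × (Fin (n + 1) → ℝ)) (x : Fin (n + 1)) :
    z.1 x ^ 2 ≤ phaseSize z :=
  (single_le_sum (f := fun y => z.1 y ^ 2) (fun _ _ => sq_nonneg _) (mem_univ x)).trans
    (sum_sq_fst_le_phaseSize z)

/-- `|φ_x| ≤ s`. -/
theorem abs_fst_le_phaseSize (z : (Fin (n + 1) → ℝ) × (Fin (n + 1) → ℝ)) (x : Fin (n + 1)) :
    |z.1 x| ≤ phaseSize z := by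
  have h : |z.1 x| ≤ 1 + z.1 x ^ 2 := by
    nlinarith [sq_nonneg (|z.1 x| - 1), sq_abs (z.1 x), abs_nonneg (z.1 x)]
  have h2 := sq_fst_le_phaseSize z x
  have h3 := one_le_phaseSize z
  unfold phaseSize at *
  have h4 : z.1 x ^ 2 ≤ ∑ y, z.1 y ^ 2 :=
    single_le_sum (f := fun y => z.1 y ^ 2) (fun _ _ => sq_nonneg _) (mem_univ x)
  have h5 : 0 ≤ ∑ y, z.2 y ^ 2 := sum_nonneg fun _ _ => sq_nonneg _
  linarith

/-- **Force bound**: `|F_x(φ)| ≤ (A + 4|λ|) s(φ, p)²`, `A = Σ_{x,y} |J_{xy} + J_{yx}|`. -/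
theorem abs_latticePhi4Force_le (J : Fin (n + 1) → Fin (n + 1) → ℝ) (lam : ℝ)
    (z : (Fin (n + 1) → ℝ) × (Fin (n + 1) → ℝ)) (x : Fin (n + 1)) :
    |latticePhi4Force J lam z.1 x|
      ≤ ((∑ a, ∑ b, |J a b + J b a|) + 4 * |lam|) * phaseSize z ^ 2 := by
  set s := phaseSize z with hs
  have hs1 : 1 ≤ s := one_le_phaseSize z
  have hrow : ∑ b, |J x b + J b x| ≤ ∑ a, ∑ b, |J a b + J b a| :=
    single_le_sum (f := fun a => ∑ b, |J a b + J b a|)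
      (fun _ _ => sum_nonneg fun _ _ => abs_nonneg _) (mem_univ x)
  have hA0 : 0 ≤ ∑ a, ∑ b, |J a b + J b a| :=
    sum_nonneg fun _ _ => sum_nonneg fun _ _ => abs_nonneg _
  unfold latticePhi4Force
  have h1 : |∑ y, (J x y + J y x) * z.1 y| ≤ (∑ a, ∑ b, |J a b + J b a|) * s := by
    calc |∑ y, (J x y + J y x) * z.1 y| ≤ ∑ y, |(J x y + J y x) * z.1 y| := abs_sum_le_sum_abs _ _
      _ ≤ ∑ y, |J x y + J y x| * s := sum_le_sum fun y _ => by
          rw [abs_mul]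
          exact mul_le_mul_of_nonneg_left (abs_fst_le_phaseSize z y) (abs_nonneg _)
      _ = (∑ y, |J x y + J y x|) * s := by rw [sum_mul]
      _ ≤ (∑ a, ∑ b, |J a b + J b a|) * s := mul_le_mul_of_nonneg_right hrow (by linarith)
  have h2 : |4 * lam * z.1 x ^ 3| ≤ 4 * |lam| * s ^ 2 := by
    rw [show |4 * lam * z.1 x ^ 3| = 4 * |lam| * (z.1 x ^ 2 * |z.1 x|) by
      rw [abs_mul, abs_mul, abs_pow, abs_of_pos (by norm_num : (0 : ℝ) < 4), pow_succ, sq_abs]]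
    have hx2 := sq_fst_le_phaseSize z x
    have hxa := abs_fst_le_phaseSize z x
    calc 4 * |lam| * (z.1 x ^ 2 * |z.1 x|) ≤ 4 * |lam| * (s * s) := by
          refine mul_le_mul_of_nonneg_left ?_ (by positivity)
          exact mul_le_mul hx2 hxa (abs_nonneg _) (by linarith)
      _ = 4 * |lam| * s ^ 2 := by ring
  calc |(∑ y, (J x y + J y x) * z.1 y) + 4 * lam * z.1 x ^ 3|
      ≤ |∑ y, (J x y + J y x) * z.1 y| + |4 * lam * z.1 x ^ 3| := abs_add_le _ _
    _ ≤ (∑ a, ∑ b, |J a b + J b a|) * s + 4 * |lam| * s ^ 2 := add_le_add h1 h2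
    _ ≤ ((∑ a, ∑ b, |J a b + J b a|) + 4 * |lam|) * s ^ 2 := by
        have : s ≤ s ^ 2 := by nlinarith
        nlinarith

/-- **Drift**: `s(φ + τp, p) ≤ (2 + 2τ²) s(φ, p)`. -/
theorem phaseSize_lfDrift_le (τ : ℝ) (z : (Fin (n + 1) → ℝ) × (Fin (n + 1) → ℝ)) :
    phaseSize (lfDrift τ z.1 z.2, z.2) ≤ (2 + 2 * τ ^ 2) * phaseSize z := by
  unfold phaseSize lfDrift
  simp only
  have h : ∑ x, (z.1 x + τ * z.2 x) ^ 2 ≤ 2 * ∑ x, z.1 x ^ 2 + 2 * τ ^ 2 * ∑ x, z.2 x ^ 2 := by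
    rw [mul_sum, mul_sum, ← sum_add_distrib]
    exact sum_le_sum fun x _ => by nlinarith [sq_nonneg (z.1 x - τ * z.2 x)]
  have h1 : 0 ≤ ∑ x, z.1 x ^ 2 := sum_nonneg fun _ _ => sq_nonneg _
  have h2 : 0 ≤ ∑ x, z.2 x ^ 2 := sum_nonneg fun _ _ => sq_nonneg _
  nlinarith [sq_nonneg τ]

/-- **Kick**: `s(φ, p − δF(φ)) ≤ (2 + 2δ²(n+1)(A + 4|λ|)²) s(φ, p)⁴`. -/
theorem phaseSize_lfKick_le (J : Fin (n + 1) → Fin (n + 1) → ℝ) (lam δ : ℝ)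
    (z : (Fin (n + 1) → ℝ) × (Fin (n + 1) → ℝ)) :
    phaseSize (z.1, lfKick J lam δ z.1 z.2)
      ≤ (2 + 2 * δ ^ 2 * (n + 1) * (((∑ a, ∑ b, |J a b + J b a|) + 4 * |lam|) ^ 2))
        * phaseSize z ^ 4 := by
  set s := phaseSize z with hs
  set G := (∑ a, ∑ b, |J a b + J b a|) + 4 * |lam| with hG
  have hs1 : 1 ≤ s := one_le_phaseSize z
  have hF : ∀ x, latticePhi4Force J lam z.1 x ^ 2 ≤ G ^ 2 * s ^ 4 := fun x => by
    have h := abs_latticePhi4Force_le J lam z x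
    have h0 : 0 ≤ G * s ^ 2 := (abs_nonneg _).trans h
    calc latticePhi4Force J lam z.1 x ^ 2 = |latticePhi4Force J lam z.1 x| ^ 2 := (sq_abs _).symm
      _ ≤ (G * s ^ 2) ^ 2 := pow_le_pow_left₀ (abs_nonneg _) h 2
      _ = G ^ 2 * s ^ 4 := by ring
  have hsum : ∑ x, (z.2 x - δ * latticePhi4Force J lam z.1 x) ^ 2
      ≤ 2 * ∑ x, z.2 x ^ 2 + 2 * δ ^ 2 * ((n + 1) * (G ^ 2 * s ^ 4)) := by
    have h1 : ∑ x, (z.2 x - δ * latticePhi4Force J lam z.1 x) ^ 2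
        ≤ ∑ x, (2 * z.2 x ^ 2 + 2 * δ ^ 2 * latticePhi4Force J lam z.1 x ^ 2) :=
      sum_le_sum fun x _ => by nlinarith [sq_nonneg (z.2 x + δ * latticePhi4Force J lam z.1 x)]
    have h2 : ∑ x, latticePhi4Force J lam z.1 x ^ 2 ≤ (n + 1) * (G ^ 2 * s ^ 4) := by
      calc ∑ x, latticePhi4Force J lam z.1 x ^ 2 ≤ ∑ _x : Fin (n + 1), G ^ 2 * s ^ 4 :=
            sum_le_sum fun x _ => hF x
        _ = (n + 1) * (G ^ 2 * s ^ 4) := by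
            rw [sum_const, card_univ, Fintype.card_fin, nsmul_eq_mul]; push_cast; ring
    rw [sum_add_distrib, ← mul_sum, ← mul_sum] at h1
    nlinarith [sq_nonneg δ]
  have hp : ∑ x, z.2 x ^ 2 ≤ s := sum_sq_snd_le_phaseSize z
  have hs' : s = 1 + ∑ x, z.1 x ^ 2 + ∑ x, z.2 x ^ 2 := by rw [hs]; rfl
  have e : phaseSize (z.1, lfKick J lam δ z.1 z.2)
      = 1 + ∑ x, z.1 x ^ 2 + ∑ x, (z.2 x - δ * latticePhi4Force J lam z.1 x) ^ 2 := rfl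
  rw [e]
  have hs3 : 1 ≤ s ^ 3 := one_le_pow₀ hs1
  have hs4 : s ≤ s ^ 4 := by nlinarith
  have hG2 : 0 ≤ δ ^ 2 * ((n + 1) * (G ^ 2 * s ^ 4)) := by positivity
  nlinarith

/-- **One qpq leapfrog step grows the size at most like `s⁴`**: `s(leapfrogQPQ z) ≤ C₁ s(z)⁴` with
`C₁ = d⁵ k`, `d = 2 + δ²/2`, `k = 2 + 2δ²(n+1)(A + 4|λ|)²`. -/
theorem phaseSize_leapfrogQPQ_le (J : Fin (n + 1) → Fin (n + 1) → ℝ) (lam δ : ℝ)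
    (z : (Fin (n + 1) → ℝ) × (Fin (n + 1) → ℝ)) :
    phaseSize (leapfrogQPQ J lam δ z)
      ≤ (2 + 2 * (δ / 2) ^ 2) ^ 5
        * (2 + 2 * δ ^ 2 * (n + 1) * (((∑ a, ∑ b, |J a b + J b a|) + 4 * |lam|) ^ 2))
        * phaseSize z ^ 4 := by
  set d := 2 + 2 * (δ / 2) ^ 2 with hd
  set k := 2 + 2 * δ ^ 2 * (n + 1) * (((∑ a, ∑ b, |J a b + J b a|) + 4 * |lam|) ^ 2) with hk
  have hd1 : 1 ≤ d := by rw [hd]; nlinarith [sq_nonneg (δ / 2)]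
  have hk1 : 1 ≤ k := by
    have : 0 ≤ 2 * δ ^ 2 * (n + 1) * (((∑ a, ∑ b, |J a b + J b a|) + 4 * |lam|) ^ 2) := by
      positivity
    rw [hk]
    linarith
  -- the three stages
  set z₁ : (Fin (n + 1) → ℝ) × (Fin (n + 1) → ℝ) := (lfDrift (δ / 2) z.1 z.2, z.2) with hz₁
  set z₂ : (Fin (n + 1) → ℝ) × (Fin (n + 1) → ℝ) := (z₁.1, lfKick J lam δ z₁.1 z₁.2) with hz₂
  set z₃ : (Fin (n + 1) → ℝ) × (Fin (n + 1) → ℝ) := (lfDrift (δ / 2) z₂.1 z₂.2, z₂.2) with hz₃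
  have e : leapfrogQPQ J lam δ z = z₃ := by
    simp only [leapfrogQPQ, hz₃, hz₂, hz₁]
  have h1 : phaseSize z₁ ≤ d * phaseSize z := phaseSize_lfDrift_le (δ / 2) z
  have h2 : phaseSize z₂ ≤ k * phaseSize z₁ ^ 4 := phaseSize_lfKick_le J lam δ z₁
  have h3 : phaseSize z₃ ≤ d * phaseSize z₂ := phaseSize_lfDrift_le (δ / 2) z₂
  have hs0 : 0 ≤ phaseSize z := (phaseSize_pos z).le
  have hs10 : 0 ≤ phaseSize z₁ := (phaseSize_pos z₁).le
  rw [e]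
  calc phaseSize z₃ ≤ d * phaseSize z₂ := h3
    _ ≤ d * (k * phaseSize z₁ ^ 4) := mul_le_mul_of_nonneg_left h2 (by linarith)
    _ ≤ d * (k * (d * phaseSize z) ^ 4) := by
        refine mul_le_mul_of_nonneg_left (mul_le_mul_of_nonneg_left ?_ (by linarith)) (by linarith)
        exact pow_le_pow_left₀ hs10 h1 4
    _ = d ^ 5 * k * phaseSize z ^ 4 := by ring

/-- **`N` leapfrog steps**: `s(leapfrogQPQ^[N] z) ≤ C^{e_N} s(z)^{4^N}` where the constant obeys
`C_{N+1} = C₁ C_N⁴` (`C₀ = 1`). -/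
theorem phaseSize_iterate_le (J : Fin (n + 1) → Fin (n + 1) → ℝ) (lam δ : ℝ) :
    ∀ N : ℕ, ∃ C : ℝ, 1 ≤ C ∧ ∀ z : (Fin (n + 1) → ℝ) × (Fin (n + 1) → ℝ),
      phaseSize ((leapfrogQPQ J lam δ)^[N] z) ≤ C * phaseSize z ^ (4 ^ N)
  | 0 => ⟨1, le_rfl, fun z => by simp⟩
  | N + 1 => by
    obtain ⟨C, hC1, hC⟩ := phaseSize_iterate_le J lam δ N
    set C₁ := (2 + 2 * (δ / 2) ^ 2) ^ 5
        * (2 + 2 * δ ^ 2 * (n + 1) * (((∑ a, ∑ b, |J a b + J b a|) + 4 * |lam|) ^ 2)) with hC₁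
    have hC₁0 : 0 ≤ C₁ := by positivity
    refine ⟨C₁ * C ^ 4, ?_, fun z => ?_⟩
    · have : 1 ≤ C₁ := by
        have hstep := phaseSize_leapfrogQPQ_le J lam δ ((fun _ => 0, fun _ => 0))
        -- at the origin: `1 ≤ s(step 0)` and `s(0) = 1`
        have h0 : phaseSize ((fun _ => (0 : ℝ), fun _ => (0 : ℝ)) : (Fin (n + 1) → ℝ) × (Fin (n + 1) → ℝ)) = 1 := by
          simp [phaseSize]
        rw [h0, one_pow, mul_one] at hstep
        exact (one_le_phaseSize _).trans hstep
      nlinarith [one_le_pow₀ (M₀ := ℝ) hC1 (n := 4)]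
    · rw [Function.iterate_succ_apply']
      have hs1 := one_le_phaseSize z
      calc phaseSize (leapfrogQPQ J lam δ ((leapfrogQPQ J lam δ)^[N] z))
          ≤ C₁ * phaseSize ((leapfrogQPQ J lam δ)^[N] z) ^ 4 := phaseSize_leapfrogQPQ_le J lam δ _
        _ ≤ C₁ * (C * phaseSize z ^ (4 ^ N)) ^ 4 :=
            mul_le_mul_of_nonneg_left (pow_le_pow_left₀ (phaseSize_pos _).le (hC z) 4) hC₁0
        _ = C₁ * C ^ 4 * phaseSize z ^ (4 ^ (N + 1)) := by
            rw [show 4 ^ (N + 1) = 4 ^ N * 4 from pow_succ 4 N, pow_mul]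
            ring

/-- The momentum flip preserves the size. -/
theorem phaseSize_momFlip (z : (Fin (n + 1) → ℝ) × (Fin (n + 1) → ℝ)) :
    phaseSize (momFlip z) = phaseSize z := by
  simp [phaseSize, momFlip]

/-! ## The energy and its violation are polynomially bounded -/

/-- `|H(z)| ≤ (Σ|J| + |λ| + 1) s(z)²`. -/
theorem abs_phi4HmcEnergy_le (J : Fin (n + 1) → Fin (n + 1) → ℝ) (lam : ℝ)
    (z : (Fin (n + 1) → ℝ) × (Fin (n + 1) → ℝ)) :
    |phi4HmcEnergy J lam z| ≤ ((∑ a, ∑ b, |J a b|) + |lam| + 1) * phaseSize z ^ 2 := by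
  set s := phaseSize z with hs
  have hs1 : 1 ≤ s := one_le_phaseSize z
  have hq := sum_sq_fst_le_phaseSize z
  have hp := sum_sq_snd_le_phaseSize z
  have hM0 : 0 ≤ ∑ a, ∑ b, |J a b| := sum_nonneg fun _ _ => sum_nonneg fun _ _ => abs_nonneg _
  -- quadratic form
  have h1 : |∑ x, ∑ y, z.1 x * J x y * z.1 y| ≤ (∑ a, ∑ b, |J a b|) * s := by
    have hxy : ∀ x y, |z.1 x * J x y * z.1 y| ≤ |J x y| * s := by
      intro x y
      rw [abs_mul, abs_mul]
      have hx := sq_fst_le_phaseSize z x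
      have hy := sq_fst_le_phaseSize z y
      have : |z.1 x| * |z.1 y| ≤ s := by
        nlinarith [sq_abs (z.1 x), sq_abs (z.1 y), sq_nonneg (|z.1 x| - |z.1 y|),
          abs_nonneg (z.1 x), abs_nonneg (z.1 y)]
      calc |z.1 x| * |J x y| * |z.1 y| = |J x y| * (|z.1 x| * |z.1 y|) := by ring
        _ ≤ |J x y| * s := mul_le_mul_of_nonneg_left this (abs_nonneg _)
    calc |∑ x, ∑ y, z.1 x * J x y * z.1 y| ≤ ∑ x, |∑ y, z.1 x * J x y * z.1 y| :=
          abs_sum_le_sum_abs _ _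
      _ ≤ ∑ x, ∑ y, |z.1 x * J x y * z.1 y| := sum_le_sum fun x _ => abs_sum_le_sum_abs _ _
      _ ≤ ∑ x, ∑ y, |J x y| * s := sum_le_sum fun x _ => sum_le_sum fun y _ => hxy x y
      _ = (∑ a, ∑ b, |J a b|) * s := by rw [sum_mul]; exact sum_congr rfl fun x _ => by rw [sum_mul]
  -- quartic term
  have h2 : |lam * ∑ x, z.1 x ^ 4| ≤ |lam| * s ^ 2 := by
    rw [abs_mul, abs_of_nonneg (sum_nonneg fun x _ => by positivity : (0 : ℝ) ≤ ∑ x, z.1 x ^ 4)]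
    refine mul_le_mul_of_nonneg_left ?_ (abs_nonneg _)
    have h4 : ∑ x, z.1 x ^ 4 ≤ (∑ x, z.1 x ^ 2) * ∑ x, z.1 x ^ 2 := by
      rw [sum_mul]
      exact sum_le_sum fun x _ => by
        have := single_le_sum (f := fun y => z.1 y ^ 2) (fun _ _ => sq_nonneg _) (mem_univ x)
        nlinarith [sq_nonneg (z.1 x)]
    have h0 : 0 ≤ ∑ x, z.1 x ^ 2 := sum_nonneg fun _ _ => sq_nonneg _
    nlinarith
  unfold phi4HmcEnergy latticePhi4Action
  calc |(∑ x, ∑ y, z.1 x * J x y * z.1 y) + lam * ∑ x, z.1 x ^ 4 + (∑ x, z.2 x ^ 2) / 2|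
      ≤ |(∑ x, ∑ y, z.1 x * J x y * z.1 y) + lam * ∑ x, z.1 x ^ 4| + |(∑ x, z.2 x ^ 2) / 2| :=
        abs_add_le _ _
    _ ≤ (|∑ x, ∑ y, z.1 x * J x y * z.1 y| + |lam * ∑ x, z.1 x ^ 4|) + (∑ x, z.2 x ^ 2) / 2 := by
        refine add_le_add (abs_add_le _ _) ?_
        rw [abs_of_nonneg (by positivity)]
    _ ≤ (∑ a, ∑ b, |J a b|) * s + |lam| * s ^ 2 + s / 2 := by linarith
    _ ≤ ((∑ a, ∑ b, |J a b|) + |lam| + 1) * s ^ 2 := by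
        have : s ≤ s ^ 2 := by nlinarith
        nlinarith [abs_nonneg lam]

/-- **`|ΔH(z)| ≤ C · s(z)^{2·4^N}`** for row 2's HMC energy violation, with an explicit `C`. -/
theorem abs_hmcDeltaH_le (J : Fin (n + 1) → Fin (n + 1) → ℝ) (lam δ : ℝ) (N : ℕ) :
    ∃ C : ℝ, 0 ≤ C ∧ ∀ z : (Fin (n + 1) → ℝ) × (Fin (n + 1) → ℝ),
      |hmcDeltaH J lam δ N z| ≤ C * phaseSize z ^ (2 * 4 ^ N) := by
  obtain ⟨C, hC1, hC⟩ := phaseSize_iterate_le J lam δ N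
  set M := (∑ a, ∑ b, |J a b|) + |lam| + 1 with hM
  have hM0 : 0 ≤ M := by rw [hM]; positivity
  refine ⟨M * (C ^ 2 + 1), by positivity, fun z => ?_⟩
  have hs1 := one_le_phaseSize z
  unfold hmcDeltaH deltaH hmcProposal
  have hΨ : phaseSize (momFlip ((leapfrogQPQ J lam δ)^[N] z)) ≤ C * phaseSize z ^ (4 ^ N) := by
    rw [phaseSize_momFlip]; exact hC z
  have hA := abs_phi4HmcEnergy_le J lam (momFlip ((leapfrogQPQ J lam δ)^[N] z))
  have hB := abs_phi4HmcEnergy_le J lam z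
  have hpow : phaseSize z ^ 2 ≤ phaseSize z ^ (2 * 4 ^ N) :=
    pow_le_pow_right₀ hs1 (by nlinarith [Nat.one_le_pow N 4 (by norm_num)])
  have hΨ2 : phaseSize (momFlip ((leapfrogQPQ J lam δ)^[N] z)) ^ 2
      ≤ C ^ 2 * phaseSize z ^ (2 * 4 ^ N) := by
    calc phaseSize (momFlip ((leapfrogQPQ J lam δ)^[N] z)) ^ 2 ≤ (C * phaseSize z ^ (4 ^ N)) ^ 2 :=
          pow_le_pow_left₀ (phaseSize_pos _).le hΨ 2
      _ = C ^ 2 * phaseSize z ^ (2 * 4 ^ N) := by rw [mul_pow, ← pow_mul, mul_comm (4 ^ N) 2]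
  calc |phi4HmcEnergy J lam (momFlip ((leapfrogQPQ J lam δ)^[N] z)) - phi4HmcEnergy J lam z|
      ≤ |phi4HmcEnergy J lam (momFlip ((leapfrogQPQ J lam δ)^[N] z))| + |phi4HmcEnergy J lam z| :=
        abs_sub _ _
    _ ≤ M * phaseSize (momFlip ((leapfrogQPQ J lam δ)^[N] z)) ^ 2 + M * phaseSize z ^ 2 :=
        add_le_add hA hB
    _ ≤ M * (C ^ 2 * phaseSize z ^ (2 * 4 ^ N)) + M * phaseSize z ^ (2 * 4 ^ N) :=
        add_le_add (mul_le_mul_of_nonneg_left hΨ2 hM0) (mul_le_mul_of_nonneg_left hpow hM0)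
    _ = M * (C ^ 2 + 1) * phaseSize z ^ (2 * 4 ^ N) := by ring

end Summit.Ventures.LatticeQCDFlow.Exactness
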